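import Mathlib
import HarnessLib
import Literature.NumberTheory.GaloisRepresentations.GaloisRep

/-!
# Stub `stub_not_essSelfDual_of_certificate` (line `birth`, crux `ExplicitRamifiedFamily`, stmt-Langlands-16778)

One violating element certifies NON-essential-self-duality of a rank-`3` representation, in trace
form. For a continuous `ρ : Γ_K → GL₃(ℚ̄_p)`: if some `σ` has `((tr M)² − tr M²)³ ≠ 8 (tr M)³ det M`
for `M = ρ(σ)`, then there is no character `χ : Γ_K → GL₁(ℚ̄_p)` with
`tr ρ(g⁻¹) = χ(g) · tr ρ(g)` for all `g`.

Proof (pure linear algebra of `3 × 3` matrices in characteristic `0`). Put `M = ρ(σ)`,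
`W = ρ(σ⁻¹)` (so `W * M = 1 = M * W`), `a = tr M`, `d = det M`, `s = χ(σ)₀₀`. Specialising the
identity at `g = σᵏ`, `k = 1, 2, 3`, gives `tr Wᵏ = sᵏ · tr Mᵏ`. Newton's identity
`6 det N = (tr N)³ − 3 tr N · tr N² + 2 tr N³` for `W` and `M` gives `det W = s³ d`, and
`det W · d = 1`, so `s³ d² = 1`. Next `adj M = d • W` (from `adj M * M = d • 1` and `M * W = 1`),
so `d · tr W = tr (adj M)`, while `2 tr (adj M) = (tr M)² − tr M²` for `3 × 3` matrices. Hence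
`(tr M)² − tr M² = 2 d s a` and `((tr M)² − tr M²)³ = 8 d³ s³ a³ = 8 a³ d`, contradicting the
certificate.
-/

set_option linter.dupNamespace false -- `Summit.Langlands.Langlands` is the mandated namespace

noncomputable section

namespace Summit.Langlands.Langlands.Cruxes.ExplicitRamifiedFamily.Birth

open Literature.NumberTheory.GaloisRepresentations

/-- Newton's identity for `3 × 3` matrices over a commutative ring:
`6 det N = (tr N)³ − 3 tr N · tr N² + 2 tr N³`. -/
private theorem six_mul_det_fin_three {R : Type*} [CommRing R] (N : Matrix (Fin 3) (Fin 3) R) :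
    6 * N.det = N.trace ^ 3 - 3 * N.trace * (N ^ 2).trace + 2 * (N ^ 3).trace := by
  have h2 : N ^ 2 = N * N := pow_two N
  have h3 : N ^ 3 = N * N * N := by rw [pow_succ, h2]
  rw [h2, h3]
  simp only [Matrix.det_fin_three, Matrix.trace_fin_three, Matrix.mul_apply, Fin.sum_univ_three]
  ring

/-- For a `3 × 3` matrix `N` over a commutative ring, `2 tr (adj N) = (tr N)² − tr N²`
(the trace of the adjugate is the second elementary symmetric function). -/
private theorem two_mul_trace_adjugate_fin_three {R : Type*} [CommRing R]
    (N : Matrix (Fin 3) (Fin 3) R) :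
    2 * N.adjugate.trace = N.trace ^ 2 - (N ^ 2).trace := by
  rw [Matrix.adjugate_fin_three, Matrix.trace_fin_three_of, pow_two, pow_two (N : Matrix _ _ R)]
  simp only [Matrix.trace_fin_three, Matrix.mul_apply, Fin.sum_univ_three]
  ring

/-- Powers of a `1 × 1` matrix: `(Aᵏ)₀₀ = (A₀₀)ᵏ`. -/
private theorem pow_apply_fin_one {R : Type*} [CommRing R] (A : Matrix (Fin 1) (Fin 1) R)
    (k : ℕ) : (A ^ k) 0 0 = A 0 0 ^ k := by
  rw [← Matrix.det_fin_one (A ^ k), Matrix.det_pow, Matrix.det_fin_one]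

/-- **STUB 3 — one violating element certifies NON-essential-self-duality** (genuine lemma, provable
now; M-sized in Lean). For continuous `ρ : Γ_K → GL₃(ℚ̄_p)`: if some `σ` has
`((tr M)² − tr M²)³ ≠ 8 (tr M)³ det M` for `M = ρ(σ)`, then there is NO character `χ` with
`tr ρ(g⁻¹) = χ(g) · tr ρ(g)` for all `g` (`ρ^∨ ≇ ρ ⊗ χ` in trace form). Proof: at `g = σ, σ², σ³` the
identity gives `tr M⁻ᵏ = sᵏ tr Mᵏ`; Newton for `M⁻¹` and `M` yields `det M⁻¹ = s³ det M`, i.e.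
`s³ d² = 1` (`d = det M`, a unit), and `tr M⁻¹ = s a` (`a = tr M`); with
`d · tr M⁻¹ = tr (adj M) = ((tr M)² − tr M²)/2 =: b` (`Matrix.adjugate_fin_three` / `mul_adjugate`)
this is `b = s a d`, so `b³ = s³ a³ d³ = a³ d`, i.e. `((tr M)² − tr M²)³ = 8 (tr M)³ det M` —
contradiction. (Check: `Sym²` of `diag(x,y)` has `b = xy·a`, `d = x³y³`, `b³ = a³d`.) [folklore] -/
theorem stub_not_essSelfDual_of_certificate :
    ∀ (p : ℕ) [Fact p.Prime] (K : Type) [Field K]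
      (ρ : Literature.NumberTheory.GaloisRepresentations.FramedGaloisRep K (PadicAlgCl p) 3),
      (∃ σ : Field.absoluteGaloisGroup K,
          ((ρ σ).val.trace ^ 2 - ((ρ σ).val ^ 2).trace) ^ 3 ≠
            8 * (ρ σ).val.trace ^ 3 * (ρ σ).val.det) →
      ¬ ∃ χ : Literature.NumberTheory.GaloisRepresentations.FramedGaloisRep K (PadicAlgCl p) 1,
          ∀ σ, (ρ σ⁻¹).val.trace = (χ σ).val 0 0 * (ρ σ).val.trace := by
  intro p _ K _ ρ ⟨σ, hσ⟩ ⟨χ, hχ⟩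
  apply hσ
  -- `W * M = 1` and `M * W = 1` for `M = ρ σ`, `W = ρ σ⁻¹`.
  have hWM : (ρ σ⁻¹).val * (ρ σ).val = 1 := by
    rw [← Units.val_mul, ← map_mul, inv_mul_cancel, map_one, Units.val_one]
  have hMW : (ρ σ).val * (ρ σ⁻¹).val = 1 := by
    rw [← Units.val_mul, ← map_mul, mul_inv_cancel, map_one, Units.val_one]
  -- The identity at `σᵏ`: `tr Wᵏ = sᵏ · tr Mᵏ`.
  have hk : ∀ k : ℕ,
      ((ρ σ⁻¹).val ^ k).trace = (χ σ).val 0 0 ^ k * ((ρ σ).val ^ k).trace := by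
    intro k
    have h := hχ (σ ^ k)
    rwa [← inv_pow, map_pow, map_pow, map_pow, Units.val_pow_eq_pow_val, Units.val_pow_eq_pow_val,
      Units.val_pow_eq_pow_val, pow_apply_fin_one] at h
  have h1 := hk 1
  have h2 := hk 2
  have h3 := hk 3
  simp only [pow_one] at h1
  -- Newton for `W` and `M`; `det W · det M = 1`.
  have hNW := six_mul_det_fin_three (ρ σ⁻¹).val
  have hNM := six_mul_det_fin_three (ρ σ).val
  rw [h1, h2, h3] at hNW
  have hdet : (ρ σ⁻¹).val.det * (ρ σ).val.det = 1 := by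
    rw [← Matrix.det_mul, hWM, Matrix.det_one]
  have h6 : (6 : PadicAlgCl p) ≠ 0 := by norm_num
  have hdetW : (ρ σ⁻¹).val.det = (χ σ).val 0 0 ^ 3 * (ρ σ).val.det := by
    apply mul_left_cancel₀ h6
    linear_combination hNW - (χ σ).val 0 0 ^ 3 * hNM
  have hsd : (χ σ).val 0 0 ^ 3 * (ρ σ).val.det ^ 2 = 1 := by
    rw [hdetW] at hdet
    linear_combination hdet
  -- Adjugate: `adj M = d • W`, so `d · tr W = tr (adj M)` and `2 tr (adj M) = a² − tr M²`.
  have hadjW : (ρ σ).val.adjugate = (ρ σ).val.det • (ρ σ⁻¹).val := by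
    calc (ρ σ).val.adjugate
        = (ρ σ).val.adjugate * ((ρ σ).val * (ρ σ⁻¹).val) := by rw [hMW, mul_one]
      _ = (ρ σ).val.det • (ρ σ⁻¹).val := by
          rw [← mul_assoc, Matrix.adjugate_mul, Matrix.smul_mul, one_mul]
  have hadj : (ρ σ).val.det * (ρ σ⁻¹).val.trace = (ρ σ).val.adjugate.trace := by
    rw [hadjW, Matrix.trace_smul, smul_eq_mul]
  have hadj2 := two_mul_trace_adjugate_fin_three (ρ σ).val
  have hX : (ρ σ).val.trace ^ 2 - ((ρ σ).val ^ 2).trace =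
      2 * (ρ σ).val.det * (χ σ).val 0 0 * (ρ σ).val.trace := by
    linear_combination (-1 : PadicAlgCl p) * hadj2 - 2 * hadj + 2 * (ρ σ).val.det * h1
  rw [hX]
  linear_combination 8 * (ρ σ).val.trace ^ 3 * (ρ σ).val.det * hsd

end Summit.Langlands.Langlands.Cruxes.ExplicitRamifiedFamily.Birth

end
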